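import Mathlib.Algebra.Polynomial.Coeff
import Mathlib.Algebra.Polynomial.BigOperators
import Mathlib.Data.Nat.Choose.Sum
import Mathlib.FieldTheory.Finiteness
import Literature.InformationTheory.QuantumCodes.WeightEnumeratorBounds
import HarnessLib

/-!
# The MacWilliams identity for additive codes over `GF(4)` (CRSS Theorem 5) and the LP bound (CRSS Theorem 21) — proofs

Topic `Literature/InformationTheory/QuantumCodes` (venture QEC, cell `qec`, PARTITION v2.4 row 06 / item 06.LPK).
This file PROVES, in the binary symplectic language of `SymplecticCodes.lean` (`SympVec n = 𝔽₂ⁿ × 𝔽₂ⁿ`,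
`sympInner`, `sympWeight`, `sympDual`, `IsAdditiveCode`), the two engines behind every «LP upper bound» of the
quantum code tables, and DISCHARGES the named fact `CRSS1998_theorem21_LP` of `WeightEnumeratorBounds.lean`:

* `card_mul_weightEnum_sympDual` — **CRSS Theorem 5** (MacWilliams identity for additive codes): for every
  subspace `S̄ ≤ Ē` and all `x, y` in a commutative ring, `|S̄| · W_{S̄⊥}(x,y) = W_{S̄}(x + 3y, x − y)`, where
  `W_{S̄}(x,y) = Σ_{v ∈ S̄} x^{n − wt v} y^{wt v}` (`weightEnum`) and `S̄⊥` is the symplectic dual. Under the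
  `GF(4)` dictionary of CRSS Thm. 2 (`(a|b) ↦ ωa + ω̄b`, trace inner product ↦ symplectic product, Hamming weight
  ↦ `sympWeight`) this is the printed statement «the weight enumerator of `C⊥` is `2^{−k} W(x+3y, x−y)`» for an
  `(n, 2^k)` additive code, cleared of the denominator.
* `sum_sympSign_filter_eq_krawtchouk4`, `sum_krawtchouk4_mul_wtDist` — the Krawtchouk form, CRSS eq. (18):
  `Σ_{w : wt w = j} (−1)^{(v,w)} = P_j(wt v, n)` and `Σ_{r=0}^{n} P_j(r,n) A_r = |C| A′_j`, with the QUATERNARY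
  Krawtchouk polynomial `krawtchouk4` of `WeightEnumeratorBounds.lean` and the weight distributions
  `A_j = wtDist S̄ j`, `A′_j = wtDist S̄⊥ j`.
* `natCast_sympWeight_add` — CRSS eq. (7): `wt(u+v) ≡ wt u + wt v + (u,v) (mod 2)`; `evenSub` — the even
  subcode `C′` of a self-orthogonal code; `card_evenSub` — «`C′` is either half or all of `C`».
* `CRSS1998_theorem21_LP_holds : CRSS1998_theorem21_LP` — **CRSS Theorem 21**: for every `[[n,k,d]]` additive
  code whose stabilizer space has no word of weight `1`, the system (16)–(21) (`CRSSLPFeasible n k d`) is solved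
  by `A_j = wtDist S̄ j`, exactly along the printed proof («(18) is a consequence of Theorem 5, and (19) follows
  from the facts that `C ⊂ C⊥` and any vectors in `C⊥` of weights between `1` and `d − 1` inclusive must also be
  in `C`. From (7), the even weight vectors in `C` form an additive subcode `C′`, which is either half or all of
  `C`; (20) then follows. If `C′` is half of `C`, then `C′ ⊂ C ⊂ C⊥ ⊂ (C′)⊥`, which yields (21).»).

Method (character sums, as in the tree's classical `Coding/MacWilliamsIdentity.lean`, but over `𝔽₂`-SUBMODULES
of `Ē` and the symplectic form): the characters `sympSign v w = (−1)^{(v,w)}`; the orthogonality relation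
`Σ_{v ∈ S̄} (−1)^{(v,w)} = |S̄| · [w ∈ S̄⊥]` (`sum_sympSign_eq`, translation by a non-orthogonal `v₀` flips every
sign); the one-letter generating sums `Σ_{b ∈ 𝔽₂²} (−1)^{(a,b)} x^{[b=0]} y^{[b≠0]} = x + 3y` (`a = 0`) /
`x − y` (`a ≠ 0`) (`sum_locSign_mul`), multiplied over the letters (`sum_sympSign_mul_monomial`); coefficient
extraction in `ℤ[X]` for the Krawtchouk form (`coeff_krawtchoukGen`).

Consequence for the census (X1): together with the certificate checker `Summits/Ventures/QEC/Census/LPCertificate.lean`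
(`no_additiveCode_of_check`) every kernel-checked LP-infeasibility certificate `lp_n_k : ¬ CRSSLPFeasible n k d`
(`Census/LPBounds/*.lean`, all `k ≥ 1` cells of CRSS Table III, `n ≤ 30`) is now an UNCONDITIONAL theorem
«no `[[n,k,d]]` additive code without a weight-1 stabilizer element».

Deliberately NOT here: the weight-1 reduction CRSS Thm. 6(e) («proof left to the reader» in print; it removes the
«no word of weight 1» hypothesis at the cost of `n ↦ n − 1`); Rains's operator-valued enumerators for GENERAL
`((n,K,d))` codes and their shadow (Thms. 1–10 of [Rains1999Shadow]) — `Rains1999_LPBound` stays a named fact;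
the enumerator form of Thm. 21 (CRSS Thm. 22).

References (read via `lit`, arXiv:quant-ph/9608006v5 = IEEE Trans. Inform. Theory 44 (1998) 1369–1387; PDF p. 13
= printed p. 12 for eq. (7), Thms. 4–5; PDF p. 27 = printed p. 26 for Thm. 21 and its proof): A. R. Calderbank,
E. M. Rains, P. W. Shor, N. J. A. Sloane, *Quantum error correction via codes over GF(4)* [CalderbankEtAl1998].
-/

namespace Literature.InformationTheory.QuantumCodes

open Finset Polynomial

variable {n : ℕ}

/-! ### 1. The characters `(-1)^{(v,w)}` of `Ē` -/

/-- The `±1`-valued character `χ(x) = (−1)^x` of `𝔽₂`. [folklore] -/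
def z2Sign (x : ZMod 2) : ℤ := if x = 0 then 1 else -1

/-- `χ(0) = 1`. [folklore] -/
@[simp] private theorem z2Sign_zero : z2Sign 0 = 1 := rfl

/-- `χ(x + y) = χ(x) χ(y)`. [folklore] -/
private theorem z2Sign_add (x y : ZMod 2) : z2Sign (x + y) = z2Sign x * z2Sign y := by
  revert x y; decide

/-- `χ(Σ_i x_i) = ∏_i χ(x_i)`. [folklore] -/
private theorem z2Sign_sum {ι : Type*} (s : Finset ι) (x : ι → ZMod 2) :
    z2Sign (∑ i ∈ s, x i) = ∏ i ∈ s, z2Sign (x i) := by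
  classical
  induction s using Finset.induction_on with
  | empty => simp
  | insert a s ha ih => rw [sum_insert ha, prod_insert ha, z2Sign_add, ih]

/-- The character `(−1)^{(v,w)}` of the symplectic space `Ē = 𝔽₂ⁿ × 𝔽₂ⁿ` attached to `w` and evaluated at `v`
(`(v,w)` the symplectic inner product (1) of CRSS): `+1` if the Pauli operators commute, `−1` if they anticommute.
[cite: CalderbankEtAl1998, §2 eq. (1) (printed p. 4) and §3 Thm. 5 (printed p. 12)] -/
def sympSign (v w : SympVec n) : ℤ := z2Sign (sympInner v w)

/-- `(−1)^{(u+v,w)} = (−1)^{(u,w)} (−1)^{(v,w)}`. [cite: CalderbankEtAl1998, §2 eq. (1) (printed p. 4)] -/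
theorem sympSign_add_left (u v w : SympVec n) : sympSign (u + v) w = sympSign u w * sympSign v w := by
  unfold sympSign; rw [sympInner_add_left, z2Sign_add]

/-- `(−1)^{(v,w)} = 1` when `(v,w) = 0`. [cite: CalderbankEtAl1998, §2 eq. (1) (printed p. 4)] -/
theorem sympSign_of_eq_zero {v w : SympVec n} (h : sympInner v w = 0) : sympSign v w = 1 := by
  simp [sympSign, z2Sign, h]

/-- `(−1)^{(v,w)} = −1` when `(v,w) ≠ 0`. [cite: CalderbankEtAl1998, §2 eq. (1) (printed p. 4)] -/
theorem sympSign_of_ne_zero {v w : SympVec n} (h : sympInner v w ≠ 0) : sympSign v w = -1 := by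
  simp [sympSign, z2Sign, h]

/-! ### 2. The character sum over an additive code -/

section CharSum

open scoped Classical in
/-- **Character sum over a subspace.** `Σ_{v ∈ S̄} (−1)^{(v,w)} = |S̄|` if `w ∈ S̄⊥` and `= 0` otherwise (the
orthogonality relation behind the MacWilliams identity for additive codes: for `w ∉ S̄⊥` pick `v₀ ∈ S̄` with
`(v₀,w) = 1`; translation by `v₀` permutes `S̄` and flips every sign).
[cite: CalderbankEtAl1998, §3 Thm. 5 (printed p. 12, «follows from the general theory of additive codes developed by Delsarte»)] -/
theorem sum_sympSign_eq (S : Submodule (ZMod 2) (SympVec n)) (w : SympVec n) :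
    ∑ v ∈ univ.filter (· ∈ S), sympSign v w =
      if w ∈ sympDual S then ((#(univ.filter (· ∈ S)) : ℕ) : ℤ) else 0 := by
  split_ifs with hw
  · rw [mem_sympDual_iff] at hw
    rw [Finset.sum_congr rfl fun v hv => sympSign_of_eq_zero (hw v (mem_filter.1 hv).2)]
    simp
  · rw [mem_sympDual_iff] at hw
    push Not at hw
    obtain ⟨v₀, hv₀, hne⟩ := hw
    set T := univ.filter (· ∈ S) with hT
    have hshift : ∑ v ∈ T, sympSign (v + v₀) w = ∑ v ∈ T, sympSign v w := by
      refine Finset.sum_equiv (Equiv.addRight v₀) (fun v => ?_) (fun v _ => rfl)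
      simp only [hT, mem_filter, mem_univ, true_and, Equiv.coe_addRight]
      constructor
      · intro hv; exact S.add_mem hv hv₀
      · intro hv; simpa using S.sub_mem hv hv₀
    have hflip : ∑ v ∈ T, sympSign (v + v₀) w = -∑ v ∈ T, sympSign v w := by
      rw [← Finset.sum_neg_distrib]
      refine Finset.sum_congr rfl fun v _ => ?_
      rw [sympSign_add_left, sympSign_of_ne_zero hne]; ring
    have : (2 : ℤ) * ∑ v ∈ T, sympSign v w = 0 := by linarith [hshift.symm.trans hflip]
    simpa using this

end CharSum

/-! ### 3. One coordinate at a time: local weights, local signs, and the generating identity -/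

section Local

/-- The one-letter weight: `0` for the identity `(0,0)`, `1` for `σ_x, σ_z, σ_y` = `(1,0), (0,1), (1,1)`.
[cite: CalderbankEtAl1998, §2 (printed p. 4, weight of (a|b))] -/
def locWt (a : ZMod 2 × ZMod 2) : ℕ := if a = 0 then 0 else 1

/-- The one-letter symplectic product `a₁ b₂ + b₁ a₂`. [cite: CalderbankEtAl1998, §2 eq. (1) (printed p. 4)] -/
def locInner (a b : ZMod 2 × ZMod 2) : ZMod 2 := a.1 * b.2 + b.1 * a.2

/-- The equivalence `Ē = 𝔽₂ⁿ × 𝔽₂ⁿ ≃ (𝔽₂ × 𝔽₂)ⁿ` reading `(a|b)` letter by letter. [folklore] -/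
def letters (n : ℕ) : SympVec n ≃ (Fin n → ZMod 2 × ZMod 2) :=
  (Equiv.arrowProdEquivProdArrow (Fin n) (fun _ => ZMod 2) (fun _ => ZMod 2)).symm

/-- `letters v i = (aᵢ, bᵢ)`. [folklore] -/
@[simp] private theorem letters_apply (v : SympVec n) (i : Fin n) : letters n v i = (v.1 i, v.2 i) := rfl

/-- The weight of `(a|b)` is the sum of its one-letter weights. [cite: CalderbankEtAl1998, §2 (printed p. 4)] -/
theorem sympWeight_eq_sum_locWt (v : SympVec n) : sympWeight v = ∑ i, locWt (letters n v i) := by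
  unfold sympWeight locWt
  rw [Finset.card_filter]
  refine Finset.sum_congr rfl fun i _ => ?_
  simp only [letters_apply, Prod.mk_eq_zero]
  by_cases h : v.1 i ≠ 0 ∨ v.2 i ≠ 0
  · rw [if_pos h, if_neg (by tauto)]
  · rw [if_neg h, if_pos (by tauto)]

/-- The symplectic inner product is the sum of the one-letter products. [cite: CalderbankEtAl1998, §2 eq. (1) (printed p. 4)] -/
theorem sympInner_eq_sum_locInner (v w : SympVec n) :
    sympInner v w = ∑ i, locInner (letters n v i) (letters n w i) := by
  simp only [sympInner, dotProduct, locInner, letters_apply, ← Finset.sum_add_distrib]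

/-- `(−1)^{(v,w)} = ∏_i (−1)^{(v_i,w_i)}`. [cite: CalderbankEtAl1998, §2 eq. (1) (printed p. 4)] -/
theorem sympSign_eq_prod (v w : SympVec n) :
    sympSign v w = ∏ i, z2Sign (locInner (letters n v i) (letters n w i)) := by
  rw [sympSign, sympInner_eq_sum_locInner, z2Sign_sum]

variable {R : Type*} [CommRing R]

/-- The one-letter generating sum: `Σ_{b ∈ 𝔽₂²} (−1)^{(a,b)} x^{1−wt b} y^{wt b}` is `x + 3y` for `a = 0` (every
letter commutes with the identity) and `x − y` for `a ≠ 0` (`b = 0` and `b = a` commute, the other two letters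
anticommute). [cite: CalderbankEtAl1998, §3 Thm. 5 (printed p. 12: `W(x+3y, x−y)`)] -/
theorem sum_locSign_mul (a : ZMod 2 × ZMod 2) (x y : R) :
    ∑ b : ZMod 2 × ZMod 2, (z2Sign (locInner a b) : R) * (if b = 0 then x else y) =
      if a = 0 then x + 3 * y else x - y := by
  obtain ⟨a₁, a₂⟩ := a
  rw [Fintype.sum_prod_type]
  have h4 : ∀ f : ZMod 2 → R, ∑ t : ZMod 2, f t = f 0 + f 1 := fun f => Fin.sum_univ_two f
  simp only [h4, locInner, z2Sign, Prod.mk_eq_zero]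
  rcases (by decide : ∀ t : ZMod 2, t = 0 ∨ t = 1) a₁ with h₁ | h₁ <;>
  rcases (by decide : ∀ t : ZMod 2, t = 0 ∨ t = 1) a₂ with h₂ | h₂ <;>
  subst h₁ h₂ <;> simp +decide <;> ring

/-- `#{i : v_i ≠ 0} = wt(v)` in letters. [cite: CalderbankEtAl1998, §2 (printed p. 4)] -/
theorem card_filter_letters_ne_zero (v : SympVec n) : #{i | letters n v i ≠ 0} = sympWeight v := by
  unfold sympWeight
  congr 1; ext i
  simp only [mem_filter, mem_univ, true_and, letters_apply, ne_eq, Prod.mk_eq_zero, not_and_or]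

/-- `#{i : v_i = 0} = n − wt(v)` in letters. [cite: CalderbankEtAl1998, §2 (printed p. 4)] -/
theorem card_filter_letters_eq_zero (v : SympVec n) : #{i | letters n v i = 0} = n - sympWeight v := by
  have h := Finset.card_filter_add_card_filter_not (s := (univ : Finset (Fin n)))
    (fun i => letters n v i = 0)
  rw [card_univ, Fintype.card_fin] at h
  have h' : #{i | ¬ letters n v i = 0} = sympWeight v := card_filter_letters_ne_zero v
  omega

/-- `∏_i (p if v_i = 0, q if v_i ≠ 0) = p^{n − wt v} q^{wt v}` — the monomial `x^{n−wt} y^{wt}` of the weight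
enumerator, read letter by letter. [cite: CalderbankEtAl1998, §3 (printed p. 12: `W(x,y) = Σ A_j x^{n−j} y^j`)] -/
theorem prod_ite_letters (v : SympVec n) (p q : R) :
    ∏ i, (if letters n v i = 0 then p else q) = p ^ (n - sympWeight v) * q ^ sympWeight v := by
  rw [Finset.prod_ite, prod_const, prod_const, card_filter_letters_eq_zero, card_filter_letters_ne_zero]

/-- **The generating identity** (one row of the MacWilliams transform): for every `v ∈ Ē` and all `x, y` in a
commutative ring, `Σ_{w ∈ Ē} (−1)^{(v,w)} x^{n − wt w} y^{wt w} = (x + 3y)^{n − wt v} (x − y)^{wt v}`.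
[cite: CalderbankEtAl1998, §3 Thm. 5 (printed p. 12)] -/
theorem sum_sympSign_mul_monomial (v : SympVec n) (x y : R) :
    ∑ w : SympVec n, (sympSign v w : R) * (x ^ (n - sympWeight w) * y ^ sympWeight w) =
      (x + 3 * y) ^ (n - sympWeight v) * (x - y) ^ sympWeight v := by
  -- the summand, letter by letter
  let g : Fin n → ZMod 2 × ZMod 2 → R := fun i b =>
    (z2Sign (locInner (letters n v i) b) : R) * (if b = 0 then x else y)
  have hsummand : ∀ w : SympVec n,
      (sympSign v w : R) * (x ^ (n - sympWeight w) * y ^ sympWeight w) = ∏ i, g i (letters n w i) := by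
    intro w
    rw [← prod_ite_letters w x y, sympSign_eq_prod, Int.cast_prod, ← prod_mul_distrib]
  rw [Fintype.sum_congr _ _ hsummand]
  -- sum over the letters of `w`, then factor
  rw [Fintype.sum_equiv (letters n) (fun w => ∏ i, g i (letters n w i)) (fun f => ∏ i, g i (f i))
    (fun w => rfl), ← Fintype.prod_sum g]
  simp only [g, sum_locSign_mul]
  exact prod_ite_letters v (x + 3 * y) (x - y)

end Local

/-! ### 4. The MacWilliams identity for additive codes (CRSS Theorem 5) -/

section MacWilliams

variable {R : Type*} [CommRing R]

open scoped Classical in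
/-- The elements of the subspace `S̄ ≤ Ē` as a `Finset` (the `(n, 2^{n−k})` additive code `C` of CRSS, through the
`GF(4)` dictionary). [cite: CalderbankEtAl1998, §2 Thm. 2 (printed p. 9)] -/
noncomputable def codeWords (S : Submodule (ZMod 2) (SympVec n)) : Finset (SympVec n) := univ.filter (· ∈ S)

open scoped Classical in
/-- Membership in `codeWords`. [cite: CalderbankEtAl1998, §2 Thm. 2 (printed p. 9)] -/
@[simp] theorem mem_codeWords {S : Submodule (ZMod 2) (SympVec n)} {v : SympVec n} :
    v ∈ codeWords S ↔ v ∈ S := by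
  simp [codeWords]

open scoped Classical in
/-- **The weight distribution** `A_j = #{v ∈ S̄ : wt v = j}` of an additive code («the weight distribution of an
`(n, 2^k)` additive code `C` is the sequence `A_0, …, A_n`, where `A_j` is the number of vectors in `C` of weight `j`»).
[cite: CalderbankEtAl1998, §3 (printed p. 12, definition of the weight distribution)] -/
noncomputable def wtDist (S : Submodule (ZMod 2) (SympVec n)) (j : ℕ) : ℕ :=
  #((codeWords S).filter fun v => sympWeight v = j)

open scoped Classical in
/-- **The weight enumerator** `W(x,y) = Σ_{v ∈ C} x^{n − wt v} y^{wt v}` of an additive code, evaluated at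
elements `x, y` of a commutative ring. [cite: CalderbankEtAl1998, §3 (printed p. 12, `W(x,y) = Σ_j A_j x^{n−j} y^j`)] -/
noncomputable def weightEnum (S : Submodule (ZMod 2) (SympVec n)) (x y : R) : R :=
  ∑ v ∈ codeWords S, x ^ (n - sympWeight v) * y ^ sympWeight v

/-- Summing a function of the weight over the code, fibrewise: `Σ_{v ∈ C, p(wt v)} f(wt v) = Σ_{j ≤ n, p j} A_j f(j)`.
[cite: CalderbankEtAl1998, §3 (printed p. 12, definition of the weight distribution)] -/
theorem sum_codeWords_filter_eq_sum_wtDist {M : Type*} [AddCommMonoid M] (S : Submodule (ZMod 2) (SympVec n))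
    (p : ℕ → Prop) [DecidablePred p] (f : ℕ → M) :
    ∑ v ∈ (codeWords S).filter (fun v => p (sympWeight v)), f (sympWeight v) =
      ∑ j ∈ (range (n + 1)).filter p, wtDist S j • f j := by
  classical
  rw [← Finset.sum_fiberwise_of_maps_to (s := (codeWords S).filter (fun v => p (sympWeight v)))
    (t := (range (n + 1)).filter p) (g := sympWeight)
    (fun v hv => mem_filter.2 ⟨mem_range.2 (Nat.lt_succ_of_le (sympWeight_le v)), (mem_filter.1 hv).2⟩)]
  refine Finset.sum_congr rfl fun j hj => ?_
  rw [Finset.sum_congr rfl fun v hv => by rw [(mem_filter.1 hv).2], sum_const]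
  congr 1
  unfold wtDist
  congr 1; ext v
  simp only [mem_filter, mem_codeWords]
  constructor
  · rintro ⟨⟨hv, _⟩, hj'⟩; exact ⟨hv, hj'⟩
  · rintro ⟨hv, hj'⟩; exact ⟨⟨hv, hj' ▸ (mem_filter.1 hj).2⟩, hj'⟩

/-- `Σ_{v ∈ C} f(wt v) = Σ_{j ≤ n} A_j f(j)`. [cite: CalderbankEtAl1998, §3 (printed p. 12)] -/
theorem sum_codeWords_eq_sum_wtDist {M : Type*} [AddCommMonoid M] (S : Submodule (ZMod 2) (SympVec n))
    (f : ℕ → M) : ∑ v ∈ codeWords S, f (sympWeight v) = ∑ j ∈ range (n + 1), wtDist S j • f j := by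
  have h := sum_codeWords_filter_eq_sum_wtDist S (fun _ => True) f
  simp only [Finset.filter_true] at h
  exact h

/-- The weight enumerator in terms of the weight distribution: `W(x,y) = Σ_{j=0}^{n} A_j x^{n−j} y^j`.
[cite: CalderbankEtAl1998, §3 (printed p. 12)] -/
theorem weightEnum_eq_sum_wtDist (S : Submodule (ZMod 2) (SympVec n)) (x y : R) :
    weightEnum S x y = ∑ j ∈ range (n + 1), (wtDist S j : R) * (x ^ (n - j) * y ^ j) := by
  unfold weightEnum
  rw [sum_codeWords_eq_sum_wtDist S (fun j => x ^ (n - j) * y ^ j)]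
  simp only [nsmul_eq_mul]

/-- **CRSS Theorem 5 (MacWilliams identity for additive codes over `GF(4)`).** «If `C` is an `(n, 2^k)` additive
code with weight enumerator `W(x,y)`, the weight enumerator of the dual code `C⊥` is given by
`2^{−k} W(x + 3y, x − y)`.» Stated cleared of the denominator, `|C| · W_{C⊥}(x,y) = W_C(x+3y, x−y)`, for the
binary-symplectic `S̄ ≤ Ē` and its symplectic dual `S̄⊥` (= `C`, `C⊥` under the `GF(4)` dictionary of their Thm. 2,
which carries the trace inner product to the symplectic one and the `GF(4)` Hamming weight to `sympWeight`), and for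
`x, y` in any commutative ring. Column: PROVED (character sum over `S̄` + the one-letter generating identity).
[cite: CalderbankEtAl1998, §3 Thm. 5 (printed p. 12)] -/
theorem card_mul_weightEnum_sympDual (S : Submodule (ZMod 2) (SympVec n)) (x y : R) :
    (#(codeWords S) : R) * weightEnum (sympDual S) x y = weightEnum S (x + 3 * y) (x - y) := by
  classical
  unfold weightEnum
  -- expand the right-hand side by the generating identity and swap the sums
  rw [← Finset.sum_congr rfl fun v _ => sum_sympSign_mul_monomial v x y, Finset.sum_comm]
  -- the character sum collapses the inner sum onto `S̄⊥`
  rw [Finset.mul_sum, ← Finset.sum_filter_add_sum_filter_not univ (· ∈ sympDual S)]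
  have h1 : ∀ w ∈ univ.filter (· ∈ sympDual S),
      ∑ v ∈ codeWords S, (sympSign v w : R) * (x ^ (n - sympWeight w) * y ^ sympWeight w) =
        (#(codeWords S) : R) * (x ^ (n - sympWeight w) * y ^ sympWeight w) := by
    intro w hw
    rw [← Finset.sum_mul, ← Int.cast_sum, codeWords, sum_sympSign_eq S w, if_pos (mem_filter.1 hw).2]
    simp
  have h0 : ∀ w ∈ univ.filter (fun w => ¬ w ∈ sympDual S),
      ∑ v ∈ codeWords S, (sympSign v w : R) * (x ^ (n - sympWeight w) * y ^ sympWeight w) = 0 := by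
    intro w hw
    rw [← Finset.sum_mul, ← Int.cast_sum, codeWords, sum_sympSign_eq S w, if_neg (mem_filter.1 hw).2]
    simp
  rw [Finset.sum_congr rfl h1, Finset.sum_congr rfl h0, sum_const_zero, add_zero]
  rfl

end MacWilliams

/-! ### 5. The Krawtchouk form: `Σ_{wt w = j} (−1)^{(v,w)} = P_j(wt v, n)` and `Σ_r P_j(r,n) A_r = |C| A′_j` -/

section Krawtchouk

/-- Coefficients of `(1 + cX)^m`: `[X^t] (1 + cX)^m = c^t C(m,t)` (binomial theorem). [folklore] -/
private theorem coeff_one_add_C_mul_X_pow (c : ℤ) (m t : ℕ) :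
    ((1 + C c * X : ℤ[X]) ^ m).coeff t = c ^ t * (m.choose t : ℤ) := by
  rw [add_comm, add_pow, finsetSum_coeff]
  have hterm : ∀ i ∈ range (m + 1),
      ((C c * X) ^ i * (1 : ℤ[X]) ^ (m - i) * (m.choose i : ℤ[X])).coeff t =
        if t = i then c ^ i * (m.choose i : ℤ) else 0 := by
    intro i _
    rw [one_pow, mul_one, mul_pow, ← C_pow, ← Polynomial.C_eq_natCast, mul_comm, ← mul_assoc, ← C_mul,
      coeff_C_mul_X_pow]
    split_ifs <;> ring
  rw [Finset.sum_congr rfl hterm, Finset.sum_ite_eq]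
  split_ifs with ht
  · rfl
  · rw [mem_range, not_lt] at ht
    rw [Nat.choose_eq_zero_of_lt (by omega), Nat.cast_zero, mul_zero]

/-- `[X^j] ((1 − X)^r (1 + 3X)^m) = Σ_{s=0}^{j} (−1)^s 3^{j−s} C(r,s) C(m,j−s)` — the quaternary Krawtchouk value
`P_j(r, r + m)` when `m = n − r`. [cite: CalderbankEtAl1998, §7 (printed p. 26, definition of `P_j(x,n)`)] -/
theorem coeff_krawtchoukGen (r m j : ℕ) :
    (((1 - X : ℤ[X]) ^ r * (1 + 3 * X) ^ m).coeff j) =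
      ∑ s ∈ range (j + 1), (-1 : ℤ) ^ s * 3 ^ (j - s) * (r.choose s : ℤ) * (m.choose (j - s) : ℤ) := by
  have h1 : (1 - X : ℤ[X]) = 1 + C (-1) * X := by rw [map_neg, C_1, neg_one_mul, sub_eq_add_neg]
  have h3 : (1 + 3 * X : ℤ[X]) = 1 + C 3 * X := by rw [show (3 : ℤ[X]) = C 3 from (map_ofNat C 3).symm]
  rw [h1, h3, coeff_mul, Finset.Nat.sum_antidiagonal_eq_sum_range_succ_mk]
  refine Finset.sum_congr rfl fun s _ => ?_
  rw [coeff_one_add_C_mul_X_pow, coeff_one_add_C_mul_X_pow]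
  ring

/-- **Krawtchouk row sums of the character table**: for `v ∈ Ē` of weight `r`, the signed count of the words of
weight `j` is the quaternary Krawtchouk value, `Σ_{w : wt w = j} (−1)^{(v,w)} = P_j(r, n)`.
[cite: CalderbankEtAl1998, §7 Thm. 21 eq. (18) (printed p. 26) with §3 Thm. 5] -/
theorem sum_sympSign_filter_eq_krawtchouk4 (v : SympVec n) (j : ℕ) :
    ∑ w ∈ univ.filter (fun w : SympVec n => sympWeight w = j), sympSign v w = krawtchouk4 n j (sympWeight v) := by
  -- the generating identity at `x = 1`, `y = X`
  have hgen := sum_sympSign_mul_monomial v (1 : ℤ[X]) X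
  simp only [one_pow, one_mul] at hgen
  have hc := congrArg (fun p : ℤ[X] => p.coeff j) hgen
  simp only [finsetSum_coeff, coeff_intCast_mul, Int.cast_id, coeff_X_pow, mul_ite, mul_one,
    mul_zero] at hc
  -- left: the filtered sum; right: the Krawtchouk value
  rw [Finset.sum_filter]
  have hl : ∑ w : SympVec n, (if sympWeight w = j then sympSign v w else 0) =
      ∑ w : SympVec n, (if j = sympWeight w then sympSign v w else 0) :=
    Finset.sum_congr rfl fun w _ => by simp only [eq_comm]
  rw [hl, hc, mul_comm, coeff_krawtchoukGen]
  unfold krawtchouk4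
  refine Finset.sum_congr rfl fun s hs => ?_
  have hsj : s ≤ j := Nat.lt_succ_iff.1 (mem_range.1 hs)
  have hr : sympWeight v ≤ n := sympWeight_le v
  rfl

open scoped Classical in
/-- **MacWilliams in weight-distribution form (CRSS eq. (18), cleared of the denominator):**
`Σ_{v ∈ C} P_j(wt v, n) = |C| · A′_j`, where `A′_j` is the number of vectors of weight `j` in the dual `C⊥`.
[cite: CalderbankEtAl1998, §7 Thm. 21 eq. (18) (printed p. 26) and §3 Thm. 5 (printed p. 12)] -/
theorem sum_krawtchouk4_codeWords (S : Submodule (ZMod 2) (SympVec n)) (j : ℕ) :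
    ∑ v ∈ codeWords S, krawtchouk4 n j (sympWeight v) = (#(codeWords S) : ℤ) * (wtDist (sympDual S) j : ℤ) := by
  classical
  -- right-hand side as a double character sum
  have hA : (wtDist (sympDual S) j : ℤ) =
      ∑ w ∈ univ.filter (fun w : SympVec n => sympWeight w = j), (if w ∈ sympDual S then (1 : ℤ) else 0) := by
    rw [Finset.sum_boole, wtDist, codeWords, Finset.filter_filter, Finset.filter_filter]
    congr 2; ext w; simp [and_comm]
  rw [hA, Finset.mul_sum]
  have hchar : ∀ w ∈ univ.filter (fun w : SympVec n => sympWeight w = j),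
      (#(codeWords S) : ℤ) * (if w ∈ sympDual S then (1 : ℤ) else 0) = ∑ v ∈ codeWords S, sympSign v w := by
    intro w _
    rw [codeWords, sum_sympSign_eq S w]
    split_ifs <;> simp
  rw [Finset.sum_congr rfl hchar, Finset.sum_comm]
  exact Finset.sum_congr rfl fun v _ => (sum_sympSign_filter_eq_krawtchouk4 v j).symm

/-- **CRSS eq. (18)**: `Σ_{r=0}^{n} P_j(r,n) A_r = |C| · A′_j` (MacWilliams transform of the weight distribution).
[cite: CalderbankEtAl1998, §7 Thm. 21 eq. (18) (printed p. 26)] -/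
theorem sum_krawtchouk4_mul_wtDist (S : Submodule (ZMod 2) (SympVec n)) (j : ℕ) :
    ∑ r ∈ range (n + 1), (krawtchouk4 n j r) * (wtDist S r : ℤ) =
      (#(codeWords S) : ℤ) * (wtDist (sympDual S) j : ℤ) := by
  rw [← sum_krawtchouk4_codeWords, sum_codeWords_eq_sum_wtDist S (fun r => krawtchouk4 n j r)]
  refine Finset.sum_congr rfl fun r _ => ?_
  rw [nsmul_eq_mul, mul_comm]

end Krawtchouk

/-! ### 6. Parity: CRSS eq. (7), the even subcode and «half or all» -/

section Parity

/-- **CRSS eq. (7)**: `wt(u + v) ≡ wt(u) + wt(v) + (u,v) (mod 2)` for all `u, v ∈ Ē` («for all `u, v ∈ GF(4)ⁿ`»,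
with `u ∗ v` = the trace inner product = the symplectic product under the dictionary). Checked letter by letter.
[cite: CalderbankEtAl1998, §3 eq. (7) (printed p. 12)] -/
theorem natCast_sympWeight_add (u v : SympVec n) :
    ((sympWeight (u + v) : ℕ) : ZMod 2) = sympWeight u + sympWeight v + sympInner u v := by
  rw [sympWeight_eq_sum_locWt, sympWeight_eq_sum_locWt u, sympWeight_eq_sum_locWt v,
    sympInner_eq_sum_locInner]
  push_cast
  rw [← Finset.sum_add_distrib, ← Finset.sum_add_distrib]
  have h : ∀ a b : ZMod 2 × ZMod 2,
      ((locWt (a + b) : ℕ) : ZMod 2) = (locWt a : ZMod 2) + (locWt b : ZMod 2) + locInner a b := by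
    unfold locWt locInner
    decide
  refine Finset.sum_congr rfl fun i _ => ?_
  have hadd : letters n (u + v) i = letters n u i + letters n v i := rfl
  rw [hadd]
  exact h _ _

/-- In a self-orthogonal `S̄` the weight parity is additive: `wt(u+v) ≡ wt u + wt v (mod 2)` for `u, v ∈ S̄`
(eq. (7) with `(u,v) = 0`). [cite: CalderbankEtAl1998, §3 eq. (7) and Thm. 4 (printed p. 12)] -/
theorem natCast_sympWeight_add_of_mem {S : Submodule (ZMod 2) (SympVec n)} (hS : IsSelfOrthogonal S)
    {u v : SympVec n} (hu : u ∈ S) (hv : v ∈ S) :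
    ((sympWeight (u + v) : ℕ) : ZMod 2) = sympWeight u + sympWeight v := by
  rw [natCast_sympWeight_add, (mem_sympDual_iff.1 (hS hv)) u hu, add_zero]

/-- **The even subcode** `C′` of a self-orthogonal additive code: «the even weight vectors in `C` form an additive
subcode `C′`» (closed under addition by eq. (7)). [cite: CalderbankEtAl1998, §7 proof of Thm. 21 (printed p. 26)] -/
def evenSub (S : Submodule (ZMod 2) (SympVec n)) (hS : IsSelfOrthogonal S) : Submodule (ZMod 2) (SympVec n) where
  carrier := {v | v ∈ S ∧ Even (sympWeight v)}
  add_mem' := by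
    rintro u v ⟨hu, hue⟩ ⟨hv, hve⟩
    refine ⟨S.add_mem hu hv, ?_⟩
    rw [← ZMod.natCast_eq_zero_iff_even] at hue hve ⊢
    rw [natCast_sympWeight_add_of_mem hS hu hv, hue, hve, add_zero]
  zero_mem' := ⟨S.zero_mem, by rw [(sympWeight_eq_zero_iff 0).2 rfl]; exact Even.zero⟩
  smul_mem' := by
    rintro c v ⟨hv, hve⟩
    rcases (by decide : ∀ t : ZMod 2, t = 0 ∨ t = 1) c with hc | hc
    · subst hc; rw [zero_smul]; exact ⟨S.zero_mem, by rw [(sympWeight_eq_zero_iff 0).2 rfl]; exact Even.zero⟩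
    · subst hc; rw [one_smul]; exact ⟨hv, hve⟩

/-- Membership in the even subcode. [cite: CalderbankEtAl1998, §7 proof of Thm. 21 (printed p. 26)] -/
theorem mem_evenSub {S : Submodule (ZMod 2) (SympVec n)} {hS : IsSelfOrthogonal S} {v : SympVec n} :
    v ∈ evenSub S hS ↔ v ∈ S ∧ Even (sympWeight v) := Iff.rfl

/-- `C′ ⊆ C`. [cite: CalderbankEtAl1998, §7 proof of Thm. 21 (printed p. 26: `C′ ⊂ C`)] -/
theorem evenSub_le (S : Submodule (ZMod 2) (SympVec n)) (hS : IsSelfOrthogonal S) : evenSub S hS ≤ S :=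
  fun _ hv => hv.1

open scoped Classical in
/-- The words of `C′` are the even-weight words of `C`. [cite: CalderbankEtAl1998, §7 proof of Thm. 21 (printed p. 26)] -/
theorem codeWords_evenSub (S : Submodule (ZMod 2) (SympVec n)) (hS : IsSelfOrthogonal S) :
    codeWords (evenSub S hS) = (codeWords S).filter fun v => Even (sympWeight v) := by
  ext v
  simp [mem_evenSub]

/-- `v + v = 0` in `Ē` (characteristic `2`). [folklore] -/
private theorem add_self_sympVec (v : SympVec n) : v + v = 0 := by
  ext i <;> exact CharTwo.add_self_eq_zero _

open scoped Classical in
/-- **«`C′` is either half or all of `C`»**: for a self-orthogonal `S̄`, either every word has even weight, or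
translation by an odd-weight word `v₁ ∈ S̄` is a bijection between the even and the odd words (by eq. (7)), so that
`2 |C′| = |C|`. [cite: CalderbankEtAl1998, §7 proof of Thm. 21 (printed p. 26)] -/
theorem card_evenSub (S : Submodule (ZMod 2) (SympVec n)) (hS : IsSelfOrthogonal S) :
    #(codeWords (evenSub S hS)) = #(codeWords S) ∨ 2 * #(codeWords (evenSub S hS)) = #(codeWords S) := by
  rw [codeWords_evenSub]
  by_cases hodd : ∃ v₁ ∈ S, ¬ Even (sympWeight v₁)
  · right
    obtain ⟨v₁, hv₁, hodd₁⟩ := hodd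
    have hodd₁' : ((sympWeight v₁ : ℕ) : ZMod 2) = 1 := by
      rcases (by decide : ∀ t : ZMod 2, t = 0 ∨ t = 1) (sympWeight v₁ : ZMod 2) with h | h
      · exact absurd (ZMod.natCast_eq_zero_iff_even.1 h) hodd₁
      · exact h
    -- even and odd words
    have hsplit := Finset.card_filter_add_card_filter_not (s := codeWords S) (fun v => Even (sympWeight v))
    -- translation by `v₁` : even → odd is a bijection
    have hbij : #((codeWords S).filter fun v => Even (sympWeight v)) =
        #((codeWords S).filter fun v => ¬ Even (sympWeight v)) := by
      refine Finset.card_bij (fun v _ => v + v₁) (fun v hv => ?_) (fun v _ v' _ h => add_right_cancel h)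
        (fun w hw => ?_)
      · rw [mem_filter, mem_codeWords] at hv ⊢
        refine ⟨S.add_mem hv.1 hv₁, fun hev => ?_⟩
        have h := natCast_sympWeight_add_of_mem hS hv.1 hv₁
        rw [ZMod.natCast_eq_zero_iff_even.2 hev, ZMod.natCast_eq_zero_iff_even.2 hv.2, hodd₁', zero_add] at h
        exact zero_ne_one h
      · rw [mem_filter, mem_codeWords] at hw
        refine ⟨w + v₁, ?_, by rw [add_assoc, add_self_sympVec, add_zero]⟩
        rw [mem_filter, mem_codeWords]
        refine ⟨S.add_mem hw.1 hv₁, ?_⟩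
        have h := natCast_sympWeight_add_of_mem hS hw.1 hv₁
        rw [hodd₁'] at h
        rw [← ZMod.natCast_eq_zero_iff_even, h]
        rcases (by decide : ∀ t : ZMod 2, t = 0 ∨ t = 1) (sympWeight w : ZMod 2) with h0 | h1
        · exact absurd (ZMod.natCast_eq_zero_iff_even.1 h0) hw.2
        · rw [h1]; decide
    omega
  · left
    push Not at hodd
    congr 1
    exact (Finset.filter_true_of_mem fun v hv => hodd v (mem_codeWords.1 hv))

end Parity

/-! ### 7. CRSS Theorem 21: the LP system (16)–(21) is feasible for every additive code -/

section Theorem21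

open scoped Classical in
/-- `|C| = 2^{dim S̄}`. [cite: CalderbankEtAl1998, §2 Thm. 2 (printed p. 9: «an (n, 2^{n−k}) code»)] -/
theorem card_codeWords (S : Submodule (ZMod 2) (SympVec n)) :
    #(codeWords S) = 2 ^ Module.finrank (ZMod 2) S := by
  rw [codeWords, ← Fintype.card_subtype, Module.card_eq_pow_finrank (K := ZMod 2) (V := S), ZMod.card]

open scoped Classical in
/-- `A_0 = 1` (only the zero word has weight `0`). [cite: CalderbankEtAl1998, §7 Thm. 21 eq. (16) (printed p. 26)] -/
theorem wtDist_zero (S : Submodule (ZMod 2) (SympVec n)) : wtDist S 0 = 1 := by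
  rw [wtDist, Finset.card_eq_one]
  refine ⟨0, ?_⟩
  ext v
  simp only [mem_filter, mem_codeWords, mem_singleton, sympWeight_eq_zero_iff]
  constructor
  · rintro ⟨_, rfl⟩; rfl
  · rintro rfl; exact ⟨S.zero_mem, rfl⟩

open scoped Classical in
/-- `A_j ≤ A′_j` for a self-orthogonal code (`C ⊂ C⊥`). [cite: CalderbankEtAl1998, §7 Thm. 21 eq. (19) (printed p. 26)] -/
theorem wtDist_le_wtDist_sympDual {S : Submodule (ZMod 2) (SympVec n)} (hS : IsSelfOrthogonal S) (j : ℕ) :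
    wtDist S j ≤ wtDist (sympDual S) j := by
  unfold wtDist
  refine Finset.card_le_card fun v hv => ?_
  rw [mem_filter, mem_codeWords] at hv ⊢
  exact ⟨hS hv.1, hv.2⟩

open scoped Classical in
/-- `A_j = A′_j` for `j ≤ d − 1`: «any vectors in `C⊥` of weights between `1` and `d − 1` inclusive must also be in
`C`». [cite: CalderbankEtAl1998, §7 Thm. 21 eq. (19) (printed p. 26)] -/
theorem wtDist_eq_wtDist_sympDual {S : Submodule (ZMod 2) (SympVec n)} {k d : ℕ} (h : IsAdditiveCode S k d)
    {j : ℕ} (hj : j < d) : wtDist S j = wtDist (sympDual S) j := by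
  unfold wtDist
  congr 1
  ext v
  rw [mem_filter, mem_codeWords, mem_filter, mem_codeWords]
  constructor
  · rintro ⟨hv, hw⟩; exact ⟨h.1 hv, hw⟩
  · rintro ⟨hv, hw⟩
    refine ⟨?_, hw⟩
    by_contra hvS
    have := h.2.2.1 v hv hvS
    omega

open scoped Classical in
/-- The dual weight distribution is antitone in the code: `T̄ ≤ S̄ ⇒ #{w ∈ S̄⊥ : wt w = j} ≤ #{w ∈ T̄⊥ : wt w = j}`
(used with `T̄ = C′`: `C⊥ ⊂ (C′)⊥`). [cite: CalderbankEtAl1998, §7 proof of Thm. 21 (printed p. 26: `C′ ⊂ C ⊂ C⊥ ⊂ (C′)⊥`)] -/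
theorem wtDist_sympDual_mono {S T : Submodule (ZMod 2) (SympVec n)} (hTS : T ≤ S) (j : ℕ) :
    wtDist (sympDual S) j ≤ wtDist (sympDual T) j := by
  unfold wtDist
  refine Finset.card_le_card fun v hv => ?_
  rw [mem_filter, mem_codeWords] at hv ⊢
  exact ⟨sympDual_anti hTS hv.1, hv.2⟩

/-- **CRSS eq. (18) over `ℝ`**: `Σ_{r=0}^{n} P_j(r,n) A_r = |C| A′_j`. [cite: CalderbankEtAl1998, §7 Thm. 21 eq. (18) (printed p. 26)] -/
theorem sum_krawtchouk4_mul_wtDist_real (S : Submodule (ZMod 2) (SympVec n)) (j : ℕ) :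
    ∑ r ∈ range (n + 1), (krawtchouk4 n j r : ℝ) * (wtDist S r : ℝ) =
      (#(codeWords S) : ℝ) * (wtDist (sympDual S) j : ℝ) := by
  have h := sum_krawtchouk4_mul_wtDist S j
  exact_mod_cast h

/-- **Discharge of the named fact `CRSS1998_theorem21_LP` (CRSS Theorem 21, LP bound for additive quantum codes).**
For an `[[n,k,d]]` additive code whose stabilizer space `S̄` (the associated `(n, 2^{n−k})` code `C`) has no word
of weight `1`, the weight distribution `A_j = #{v ∈ C : wt v = j}` solves (16)–(21): (16) `A_0 = 1`, `A_1 = 0`,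
`A_j ≥ 0`; (17) `Σ A_j = 2^{n−k}` (`|C| = 2^{dim S̄}`, `dim S̄ = n − k`); (18)–(19) by the MacWilliams identity
(Thm. 5, `sum_krawtchouk4_mul_wtDist`) `A′_j` IS the weight distribution of `C⊥`, and `C ⊂ C⊥` with the
low-weight words of `C⊥` in `C`; (20) the even subcode `C′` is half or all of `C` (eq. (7)); (21) the MacWilliams
identity for `C′` together with `C⊥ ⊂ (C′)⊥` and `2|C′| ≥ |C|`. Column: PROVED.
[cite: CalderbankEtAl1998, §7 Thm. 21 with its proof (printed p. 26)] -/
theorem CRSS1998_theorem21_LP_holds : CRSS1998_theorem21_LP := by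
  classical
  intro n k d S h hw1
  -- the code, its size, its even subcode
  have hNk : n - k = Module.finrank (ZMod 2) S := by have := h.2.1; omega
  have hcardR : (#(codeWords S) : ℝ) = (2 : ℝ) ^ (n - k) := by
    rw [card_codeWords S, hNk]; push_cast; rfl
  have hS : IsSelfOrthogonal S := h.1
  have hce := card_evenSub S hS
  -- the candidate solution `A_j = #{v ∈ C : wt v = j}`
  refine ⟨fun j => (wtDist S j : ℝ), ?_, ?_, ?_, ?_, ?_, ?_, ?_, ?_⟩
  -- (16) A_0 = 1
  · simp [wtDist_zero]
  -- (16) A_1 = 0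
  · have h0 : wtDist S 1 = 0 := by
      rw [wtDist, Finset.card_eq_zero, Finset.filter_eq_empty_iff]
      intro v hv; exact hw1 v (mem_codeWords.1 hv)
    simp [h0]
  -- (16) A_j ≥ 0
  · intro j _; exact Nat.cast_nonneg _
  -- (17) Σ A_j = 2^{n−k}
  · have hsum := sum_codeWords_eq_sum_wtDist S (fun _ => (1 : ℝ))
    simp only [sum_const, nsmul_eq_mul, mul_one] at hsum
    rw [← hsum, hcardR]
  -- (19) A_j = A′_j for j < d
  · intro j hjd
    have hj : wtDist S j = wtDist (sympDual S) j := wtDist_eq_wtDist_sympDual h (by omega)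
    unfold crssDual
    rw [sum_krawtchouk4_mul_wtDist_real, hcardR, ← mul_assoc, one_div_mul_cancel (pow_ne_zero _ two_ne_zero),
      one_mul]
    beta_reduce
    exact_mod_cast hj
  -- (19) A_j ≤ A′_j for d ≤ j
  · intro j _ _
    have hj : wtDist S j ≤ wtDist (sympDual S) j := wtDist_le_wtDist_sympDual hS j
    unfold crssDual
    rw [sum_krawtchouk4_mul_wtDist_real, hcardR, ← mul_assoc, one_div_mul_cancel (pow_ne_zero _ two_ne_zero),
      one_mul]
    beta_reduce
    exact_mod_cast hj
  -- (20) Σ_j A_{2j} = 2^{n−k−1} or 2^{n−k}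
  · have heven : ∑ j ∈ (range (n + 1)).filter Even, (wtDist S j : ℝ) = (#(codeWords (evenSub S hS)) : ℝ) := by
      have h' := sum_codeWords_filter_eq_sum_wtDist S Even (fun _ => (1 : ℝ))
      simp only [sum_const, nsmul_eq_mul, mul_one] at h'
      rw [← h', codeWords_evenSub]
    beta_reduce
    rw [heven, ← hcardR]
    rcases hce with hall | hhalf
    · right; exact_mod_cast hall
    · left; exact_mod_cast hhalf
  -- (21) 2^{−(n−k−1)} Σ_r P_j(2r,n) A_{2r} ≥ A′_j
  · intro j _
    beta_reduce
    unfold crssDual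
    rw [← mul_assoc, mul_one_div_cancel (pow_ne_zero _ two_ne_zero), one_mul, sum_krawtchouk4_mul_wtDist_real]
    -- the even part of the sum is the MacWilliams transform of `C′`
    have heven : ∑ r ∈ (range (n + 1)).filter Even, (krawtchouk4 n j r : ℝ) * (wtDist S r : ℝ) =
        (#(codeWords (evenSub S hS)) : ℝ) * (wtDist (sympDual (evenSub S hS)) j : ℝ) := by
      rw [← sum_krawtchouk4_mul_wtDist_real (evenSub S hS) j]
      have h1 := sum_codeWords_filter_eq_sum_wtDist S Even (fun r => (krawtchouk4 n j r : ℝ))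
      have h2 := sum_codeWords_eq_sum_wtDist (evenSub S hS) (fun r => (krawtchouk4 n j r : ℝ))
      simp only [nsmul_eq_mul] at h1 h2
      rw [Finset.sum_congr rfl fun r _ => mul_comm ((krawtchouk4 n j r : ℝ)) _, ← h1,
        Finset.sum_congr rfl fun r _ => mul_comm ((krawtchouk4 n j r : ℝ)) _, ← h2, codeWords_evenSub]
    rw [heven]
    -- `|C| A′_j ≤ 2 |C′| #{w ∈ (C′)⊥ : wt w = j}`
    have hle1 : wtDist (sympDual S) j ≤ wtDist (sympDual (evenSub S hS)) j :=
      wtDist_sympDual_mono (evenSub_le S hS) j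
    have hle2 : #(codeWords S) ≤ 2 * #(codeWords (evenSub S hS)) := by
      rcases hce with hall | hhalf <;> omega
    have hle : #(codeWords S) * wtDist (sympDual S) j ≤
        2 * #(codeWords (evenSub S hS)) * wtDist (sympDual (evenSub S hS)) j :=
      Nat.mul_le_mul hle2 hle1
    calc (#(codeWords S) : ℝ) * (wtDist (sympDual S) j : ℝ)
        = ((#(codeWords S) * wtDist (sympDual S) j : ℕ) : ℝ) := by push_cast; ring
      _ ≤ ((2 * #(codeWords (evenSub S hS)) * wtDist (sympDual (evenSub S hS)) j : ℕ) : ℝ) := by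
          exact_mod_cast hle
      _ = 2 * ((#(codeWords (evenSub S hS)) : ℝ) * (wtDist (sympDual (evenSub S hS)) j : ℝ)) := by
          push_cast; ring

end Theorem21

end Literature.InformationTheory.QuantumCodes
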